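import Literature.AlgebraicGeometry.Frobenioids.MotivatingExamplesSubHoldsB
import Mathlib.FieldTheory.IsAlgClosed.AlgebraicClosure
import Mathlib.FieldTheory.IsSepClosed
import Mathlib.NumberTheory.Cyclotomic.Basic
import HarnessLib

/-!
# Frobenioids I, §6 sub-DAG rows E63/L05 `Ex63_hypotheses` and E63/L06 `Ex63_isFrobenioid` (Example 6.3)
# HEAD-MATCHED AT DATA — PROOF-ONLY

Mochizuki, *The geometry of Frobenioids I: the general theory*, Kyushu J. Math. **62** (2008) 293–400, §6,
Example 6.3 ("A Frobenioid of arithmetic origin"), kurims text p. 113: "Let `F` be a number field … if `F̃` is a [not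
necessarily finite] Galois extension of `F`, `G = Gal(F̃/F)`, `D = B(G)⁰`, then `Φ`, `B` determine monoids on `D`, and we
have a natural homomorphism `B → Φ^gp` … Thus, by Theorem 5.2, (ii), this data determines a [model] Frobenioid
`C_{F̃/F}`" [cite: MochizukiFrdI2008, Ex. 6.3 p.113]
(quoted from the kurims text; the journal printing, doi:10.2206/kyushujm.62.293 pp. 389–393, has the same words with
parentheses in place of the square brackets).

PROOF-ONLY companion (cell abc-iut, block F, seat abc-iut-f-001, KEY INST59K1; FROZEN FACT-LIST rows F-1129
`Ex63_hypotheses`, F-1130 `Ex63_isFrobenioid` of abc-iut-L1-t1's `MotivatingExamplesSub.lean`; 0 `def`, 0 `instance`,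
0 `structure`, no notation, nothing restated; the declaring file is imported — through abc-iut-L6-t10's
`MotivatingExamplesSubHoldsB.lean` — never edited).

WHAT THE KERNEL RECORDS.  Both rows are predicates of free fields `F ⊆ K` (`F` a number field); print's "`F̃/F` Galois" is
not among their binders, so their universal closures are FALSE as typed (abc-iut-f-013 / abc-iut-f-043 at the rigid cubic
field `ℚ(∛2)/ℚ`: `not_forall_Ex63_hypotheses`, `not_forall_ex63_isFrobenioid`), while the closers of record
(`Ex63_hypotheses_holds`, `Ex63_isFrobenioid_holds`, abc-iut-L6-t10) are universal under the printed binder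
`[IsGalois F K]`; hence no theorem of the tree had either predicate as conclusion HEAD at concrete data.  This file
supplies such instance forms at GENUINE data, all binders closed or reduced to the predicates' own:
* `F = ℚ`, `F̃ = ℚ̄` an algebraic closure (`AlgebraicClosure ℚ`; the Frobenioid `C_{ℚ̄/ℚ}`) — the ℚ-algebra structure
  on `ℚ̄` found by elaboration is `DivisionRing.toRatAlgebra`, definitionally (not reducibly) equal to `AlgebraicClosure`'s
  own, so "`ℚ̄/ℚ` is Galois" is supplied inline in the proofs (separable closure of a perfect field; no instance declared);
* every number field `F` with `F̃ = F̄` (`AlgebraicClosure F`) — the predicates' own binders `(F) [NumberField F]` only;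
* `F = ℚ`, `F̃ = ℚ(ζ₅)` (`CyclotomicField 5 ℚ`; the cyclotomic-extension instance is again passed by name across the
  ℚ-algebra diamond), and every number field `F` with `F̃ = F(ζ_n)` (`CyclotomicField n F`) — finite Galois extensions;
* every number field `F` with `F̃ = F` (the trivial Galois extension, allowed by "[not necessarily finite] Galois").

An instance-form theorem about OUR typed statement ≠ a theorem about [FrdI] in print; classical, undisputed mathematics;
nothing here bears on [IUTchIII] Cor. 3.12 or asserts anything about abc; typed ≠ proved for anything not in this file.
-/

namespace Literature.AlgebraicGeometry.Frobenioids

/-! ### Row E63/L05 — F-1129 `Ex63_hypotheses` (the hypotheses of Thm. 5.2 for the data of Ex. 6.3) -/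

/-- **F-1129 at `F = ℚ`, `F̃ = ℚ̄`**: the standing hypotheses of Thm. 5.2 for the data `(D, Φ, B, B → Φ^gp)` of
Ex. 6.3 ("`Φ`, `B` determine monoids on `D`") HOLD for `C_{ℚ̄/ℚ}` — INSTANCE at genuine data, every binder closed; by
abc-iut-L6-t10's `Ex63_hypotheses_holds`. [cite: MochizukiFrdI2008, Ex. 6.3 p.113] -/
theorem Ex63_hypotheses_rat_algebraicClosure : Ex63_hypotheses ℚ (AlgebraicClosure ℚ) := by
  haveI : IsGalois ℚ (AlgebraicClosure ℚ) :=
    @IsSepClosure.isGalois ℚ _ (AlgebraicClosure ℚ) _ _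
      (@IsSepClosure.of_isAlgClosure_of_perfectField ℚ _ (AlgebraicClosure ℚ) _ _
        (AlgebraicClosure.instIsAlgClosure ℚ) _)
  exact Ex63_hypotheses_holds ℚ _

/-- **F-1129 for every number field `F` with `F̃ = F̄`** (an algebraic closure): the hypotheses of Thm. 5.2 hold for
`C_{F̄/F}`. [cite: MochizukiFrdI2008, Ex. 6.3 p.113] -/
theorem Ex63_hypotheses_algebraicClosure (F : Type) [Field F] [NumberField F] :
    Ex63_hypotheses F (AlgebraicClosure F) :=
  Ex63_hypotheses_holds F _

/-- **F-1129 at `F = ℚ`, `F̃ = ℚ(ζ₅)`** (a finite Galois extension), every binder closed.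
[cite: MochizukiFrdI2008, Ex. 6.3 p.113] -/
theorem Ex63_hypotheses_rat_cyclotomicField_five : Ex63_hypotheses ℚ (CyclotomicField 5 ℚ) := by
  haveI : IsGalois ℚ (CyclotomicField 5 ℚ) :=
    @IsCyclotomicExtension.isGalois {5} ℚ (CyclotomicField 5 ℚ) _ _ _
      (CyclotomicField.instIsCyclotomicExtensionSingletonNatSetOfCharZero 5 ℚ)
  exact Ex63_hypotheses_holds ℚ _

/-- **F-1129 for every number field `F` with `F̃ = F(ζ_n)`**. [cite: MochizukiFrdI2008, Ex. 6.3 p.113] -/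
theorem Ex63_hypotheses_cyclotomicField (F : Type) [Field F] [NumberField F] (n : ℕ) :
    Ex63_hypotheses F (CyclotomicField n F) := by
  haveI : IsGalois F (CyclotomicField n F) := IsCyclotomicExtension.isGalois {n} F _
  exact Ex63_hypotheses_holds F _

/-- **F-1129 for every number field `F` with `F̃ = F`** (the trivial Galois extension).
[cite: MochizukiFrdI2008, Ex. 6.3 p.113] -/
theorem Ex63_hypotheses_self (F : Type) [Field F] [NumberField F] : Ex63_hypotheses F F :=
  Ex63_hypotheses_holds F F

/-! ### Row E63/L06 — F-1130 `Ex63_isFrobenioid` ("by Theorem 5.2, (ii), this data determines a [model] Frobenioid") -/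

/-- **F-1130 at `F = ℚ`, `F̃ = ℚ̄`**: the functor `C_{ℚ̄/ℚ} → F_Φ` of the constructed arithmetic model IS a Frobenioid
(Def. 1.3) — INSTANCE at genuine data, every binder closed; by abc-iut-L6-t10's `Ex63_isFrobenioid_holds`.
[cite: MochizukiFrdI2008, Ex. 6.3 p.113] -/
theorem Ex63_isFrobenioid_rat_algebraicClosure : Ex63_isFrobenioid ℚ (AlgebraicClosure ℚ) := by
  haveI : IsGalois ℚ (AlgebraicClosure ℚ) :=
    @IsSepClosure.isGalois ℚ _ (AlgebraicClosure ℚ) _ _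
      (@IsSepClosure.of_isAlgClosure_of_perfectField ℚ _ (AlgebraicClosure ℚ) _ _
        (AlgebraicClosure.instIsAlgClosure ℚ) _)
  exact Ex63_isFrobenioid_holds ℚ _

/-- **F-1130 for every number field `F` with `F̃ = F̄`**: `C_{F̄/F}` is a Frobenioid.
[cite: MochizukiFrdI2008, Ex. 6.3 p.113] -/
theorem Ex63_isFrobenioid_algebraicClosure (F : Type) [Field F] [NumberField F] :
    Ex63_isFrobenioid F (AlgebraicClosure F) :=
  Ex63_isFrobenioid_holds F _

/-- **F-1130 at `F = ℚ`, `F̃ = ℚ(ζ₅)`**, every binder closed. [cite: MochizukiFrdI2008, Ex. 6.3 p.113] -/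
theorem Ex63_isFrobenioid_rat_cyclotomicField_five : Ex63_isFrobenioid ℚ (CyclotomicField 5 ℚ) := by
  haveI : IsGalois ℚ (CyclotomicField 5 ℚ) :=
    @IsCyclotomicExtension.isGalois {5} ℚ (CyclotomicField 5 ℚ) _ _ _
      (CyclotomicField.instIsCyclotomicExtensionSingletonNatSetOfCharZero 5 ℚ)
  exact Ex63_isFrobenioid_holds ℚ _

/-- **F-1130 for every number field `F` with `F̃ = F(ζ_n)`**. [cite: MochizukiFrdI2008, Ex. 6.3 p.113] -/
theorem Ex63_isFrobenioid_cyclotomicField (F : Type) [Field F] [NumberField F] (n : ℕ) :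
    Ex63_isFrobenioid F (CyclotomicField n F) := by
  haveI : IsGalois F (CyclotomicField n F) := IsCyclotomicExtension.isGalois {n} F _
  exact Ex63_isFrobenioid_holds F _

/-- **F-1130 for every number field `F` with `F̃ = F`**: `C_{F/F}` is a Frobenioid.
[cite: MochizukiFrdI2008, Ex. 6.3 p.113] -/
theorem Ex63_isFrobenioid_self (F : Type) [Field F] [NumberField F] : Ex63_isFrobenioid F F :=
  Ex63_isFrobenioid_holds F F

end Literature.AlgebraicGeometry.Frobenioids
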